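import Summits.BirchSwinnertonDyer.BirchSwinnertonDyer.Theorems.AdditiveKolyvaginRoadLevelSystemsOfSelmerDichotomy
import Summits.BirchSwinnertonDyer.BirchSwinnertonDyer.Theses.AdditiveKolyvaginRoad
import HarnessLib

/-!
# Route `AdditiveKolyvaginRoad`, crux `LevelKolyvaginSystemsAdditive` (item stmt-BirchSwinnertonDyer-21396, KS′):
# THE CRUX BY NAME from the route's TARGET `KolyvaginPrimitiveAdditive` BY NAME and one displayed E-side binder
# (cell `pub/bsd-wall`, lead prover `cruxlead-stmt-BirchSwinnertonDyer-21396` g2; `--supports stmt-BirchSwinnertonDyer-21396`,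
# helper; the by-name socket of `…LevelSystemsSyntheticCore` ∕ `…LevelSystemsOfSelmerDichotomy`)

WHAT. `levelKolyvaginSystemsAdditive_of_kolyvaginPrimitiveAdditive`:
`KolyvaginPrimitiveAdditive → LevelKolyvaginSystemsAdditive` (KPA′ ⟹ KS′, both BY NAME), granted ONE displayed ∀-frame
E-side binder (DICH): at every ♯-type frame (`p ≥ 5`, `ρ̄_{E,p}` onto, `K` imaginary quadratic with odd `d_K < −4`, `c ≠ 1`),
for every family `𝒮 n m μ` with the membership dictionary of the level-`n` `μ`-eigen Selmer space of `E[p]` transverse on the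
Kolyvagin primes of `m`, the Kolyvagin dichotomy (Lower) ∕ (Raise) at non-empty even levels and the two-step admissible
lowering between even levels hold. (DICH) is Selmer algebra of `E[p]` over `K` at auxiliary primes — Mazur–Rubin Lemma 4.1.7,
W. Zhang Lemma 5.3 ∕ Prop. 5.4 ∕ Lemma 8.2 ∕ 8.4, Poitou–Tate — of the kind the route has landed for `m = ∅`
(`selQP_lower_of_detected`, `selQP_raise_free`, `exists_relaxed_notMem_torsionLocalKer_of_admQ`) and as the LOC package
(`kolyvaginLocalPackageP_of_poitouTate`), all modulo the named fact `poitouTate_selmerStructure_duality`; it mentions no modular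
form, no Heegner point, no L-value.

READING (for the planners of crux 21396). The route's kernel is `PUB → DUAL → KS′ → BOT′ → KPA′` (item 21266, proved) and
`KPA′ → BOT′` is `bottomRankOneAdditive_of_kolyvaginPrimitiveAdditive`; this file adds `DICH → KPA′ → KS′`. Hence, modulo the
published E-side inputs PUB ∕ DUAL ∕ DICH, **KS′-as-typed is equivalent to the target KPA′**: the carrier `LevelKolyvaginSystemP`
(genuine classes pinned only at level `∅`; provenance-free classes above) isolates NONE of W. Zhang's `p²`-level mathematics
(type-preserving level raising, Bertolini–Darmon reciprocity, Ihara ∕ multiplicity one, the rank-0 anchor). In particular on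
every locus where KPA′ is known at the frame (e.g. `p ∤ [E(K) : ℤ y_K]`, the Kriz–Li certificate locus of the (γ)-avatar line),
KS′ holds there by Selmer algebra alone. The repair is a RE-TYPING with provenance rows (`κ m n` realises the level-raised
classes `c_p(∏m, ∏n)` on `X_{N⁺p², N⁻∏n}` at EVERY level), not a proof of the present text via Zhang's machinery.

HONEST FRAMING: one theorem; 0 definitions, 0 named facts, 0 `sorry`; CONDITIONAL on (DICH) and on KPA′ (open at `p² ∣ N`);
closes nothing. BSD is not proved by any of this; KS′ and KPA′ stay OPEN.

References: [cite: WZhang2014, §3.9 (3.30), Thm. 4.3, Lemma 5.3, Prop. 5.4, Thm. 7.2, §8.1 (8.1), Lemma 8.2, Lemma 8.4, §9]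
[cite: MazurRubin2004, Lemma 4.1.7, Prop. 4.5.8] [cite: Howard2006Bipartite, Cor. 2.3.5] [cite: GrossLMS1991, §3, Prop. 6.2].
-/

-- single-conjunct summit: `Summit.BirchSwinnertonDyer.BirchSwinnertonDyer.…` repeats the name by design
set_option linter.dupNamespace false

noncomputable section

open scoped Classical

namespace Summit.BirchSwinnertonDyer.BirchSwinnertonDyer.Theorems.AdditiveKoly

open WeierstrassCurve NumberField IsDedekindDomain
  Literature.NumberTheory.EllipticCurves Literature.NumberTheory.EllipticCurves.ModularForms
  Literature.NumberTheory.EllipticCurves.Rank1Residual Literature.NumberTheory.GaloisRepresentations Module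
  Summit.BirchSwinnertonDyer.Rank1Residual.X11b.Three.Koly
  Summit.BirchSwinnertonDyer.BirchSwinnertonDyer.Theses.AdditiveKolyvaginRoad

/-- **KS′ BY NAME from KPA′ BY NAME and the E-side dichotomies (DICH).** `KolyvaginPrimitiveAdditive →
LevelKolyvaginSystemsAdditive`, granted the displayed ∀-frame binder `hDich`: at every ♯-type frame and for every family `𝒮`
with the membership dictionary of the level-`n` eigen-Selmer spaces of `E[p]` transverse on `m`, the Kolyvagin dichotomy
(Lower) ∕ (Raise) at non-empty even levels and the two-step admissible lowering. Proof: at a frame, take the intended family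
(`exists_transverseLevelSpaces`), read (DICH) for it, and run the synthetic system
(`nonempty_levelKolyvaginSystemP_of_selmerDichotomy`) on the KPA′ witness of the frame. [cite: WZhang2014, Thm. 4.3, Lemma 5.3,
Prop. 5.4, Thm. 7.2, §8.1, Lemma 8.2, Lemma 8.4] [cite: MazurRubin2004, Lemma 4.1.7, Prop. 4.5.8] -/
theorem levelKolyvaginSystemsAdditive_of_kolyvaginPrimitiveAdditive
    (hDich : ∀ (W : WeierstrassCurve ℚ) [W.IsElliptic] [W.IsGloballyMinimal] [NeZero (W.conductorNorm ℤ)] (p : ℕ)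
      [Fact p.Prime] (K : Type) [Field K] [NumberField K] (ι : K →+* ℂ) (c : K ≃ₐ[ℚ] K) [Module (ZMod p) (Vp W K p)],
      5 ≤ p → W.HasSurjectiveModNGaloisRep p → IsImaginaryQuadratic K → Odd (NumberField.discr K) →
      NumberField.discr K < -4 → c ≠ 1 →
      ∀ 𝒮 : Finset (AdmQ W K p) → Finset {ℓ // Zhang2014.IsKolyvaginPrime (W.conductorNorm ℤ) W K p ℓ} → Bool →
        Submodule (ZMod p) (Vp W K p),
      (∀ (n : Finset (AdmQ W K p)) (m : Finset {ℓ // Zhang2014.IsKolyvaginPrime (W.conductorNorm ℤ) W K p ℓ})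
          (μ : Bool) (x : Vp W K p), x ∈ 𝒮 n m μ ↔
            conjAct W c ((p ^ 1 : ℕ) : ℤ) x = sgnP μ • x ∧
            (∀ w : InfinitePlace K, x ∈ selmerLocalKer (W.baseChange K) w.Completion ((p ^ 1 : ℕ) : ℤ)) ∧
            (∀ v : HeightOneSpectrum (𝓞 K), (∀ ℓ ∈ m, ((ℓ : ℕ) : 𝓞 K) ∉ v.asIdeal) → (∀ q ∈ n, ((q : ℕ) : 𝓞 K) ∉ v.asIdeal) →
              x ∈ selmerLocalKer (W.baseChange K) (v.adicCompletion K) ((p ^ 1 : ℕ) : ℤ)) ∧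
            (∀ q ∈ n, ∀ v : HeightOneSpectrum (𝓞 K), ((q : ℕ) : 𝓞 K) ∈ v.asIdeal →
              x ∈ toricLocalKer (W.baseChange K) (v.adicCompletion K) ((p ^ 1 : ℕ) : ℤ)) ∧
            (∀ ℓ ∈ m, ∀ v : HeightOneSpectrum (𝓞 K), ((ℓ : ℕ) : 𝓞 K) ∈ v.asIdeal → x ∈ transverseLocalKerP W K p ι ℓ v)) →
      (∀ (n : Finset (AdmQ W K p)), n.Nonempty → Even n.card →
          ∀ (m : Finset {ℓ // Zhang2014.IsKolyvaginPrime (W.conductorNorm ℤ) W K p ℓ})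
            (ℓ : {ℓ // Zhang2014.IsKolyvaginPrime (W.conductorNorm ℤ) W K p ℓ}) (μ : Bool) (v : HeightOneSpectrum (𝓞 K)),
            ℓ ∉ m → ((ℓ : ℕ) : 𝓞 K) ∈ v.asIdeal →
            (∃ x ∈ 𝒮 n m μ, x ∉ (W.baseChange K).torsionLocalKer (v.adicCompletion K) ((p ^ 1 : ℕ) : ℤ)) →
            (∀ y ∈ 𝒮 n (insert ℓ m) μ, y ∈ (W.baseChange K).torsionLocalKer (v.adicCompletion K) ((p ^ 1 : ℕ) : ℤ)) ∧
              finrank (ZMod p) (𝒮 n (insert ℓ m) μ) + 1 = finrank (ZMod p) (𝒮 n m μ)) ∧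
      (∀ (n : Finset (AdmQ W K p)), n.Nonempty → Even n.card →
          ∀ (m : Finset {ℓ // Zhang2014.IsKolyvaginPrime (W.conductorNorm ℤ) W K p ℓ})
            (ℓ : {ℓ // Zhang2014.IsKolyvaginPrime (W.conductorNorm ℤ) W K p ℓ}) (μ : Bool) (v : HeightOneSpectrum (𝓞 K)),
            ℓ ∉ m → ((ℓ : ℕ) : 𝓞 K) ∈ v.asIdeal →
            (∀ x ∈ 𝒮 n m μ, x ∈ (W.baseChange K).torsionLocalKer (v.adicCompletion K) ((p ^ 1 : ℕ) : ℤ)) →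
            finrank (ZMod p) (𝒮 n (insert ℓ m) μ) = finrank (ZMod p) (𝒮 n m μ) + 1) ∧
      (∀ (n : Finset (AdmQ W K p)) (q₁ q₂ : AdmQ W K p), n.Nonempty → Even n.card → q₁ ∉ n → q₂ ∉ insert q₁ n →
          ∀ (m : Finset {ℓ // Zhang2014.IsKolyvaginPrime (W.conductorNorm ℤ) W K p ℓ}) (μ : Bool),
            finrank (ZMod p) (𝒮 (insert q₂ (insert q₁ n)) m true) + finrank (ZMod p) (𝒮 (insert q₂ (insert q₁ n)) m false) = 1 →
            (∃ g ∈ 𝒮 (insert q₂ (insert q₁ n)) m μ, ∃ v : HeightOneSpectrum (𝓞 K), ((q₂ : ℕ) : 𝓞 K) ∈ v.asIdeal ∧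
              g ∉ (W.baseChange K).torsionLocalKer (v.adicCompletion K) ((p ^ 1 : ℕ) : ℤ)) →
            finrank (ZMod p) (𝒮 n m true) + finrank (ZMod p) (𝒮 n m false) = 1))
    (hKPA : KolyvaginPrimitiveAdditive) : LevelKolyvaginSystemsAdditive := by
  intro W _ _ _ p _ K _ _ Dt β ι h5 hadd hsurj hsp htwo htam hr1 hK hodd hlt hH hL hβ hcM c hc1 _
  obtain ⟨𝒮, h𝒮, hfin⟩ := exists_transverseLevelSpaces W K p ι c
  obtain ⟨hLower, hRaise, hTwo⟩ := hDich W p K ι c h5 hsurj hK hodd hlt hc1 𝒮 h𝒮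
  exact nonempty_levelKolyvaginSystemP_of_selmerDichotomy W K p Dt β ι c hK hH hβ 𝒮 h𝒮 hfin hLower hRaise hTwo
    (hKPA W p K Dt β ι h5 hadd hsurj hsp htwo htam hr1 hK hodd hlt hH hL hβ hcM)

end Summit.BirchSwinnertonDyer.BirchSwinnertonDyer.Theorems.AdditiveKoly

end
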